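import Mathlib
import Literature.NumberTheory.LFunctions.WeilGroundState
import Literature.NumberTheory.LFunctions.WeilGroundStateRealZerosProofs
import Summits.RiemannHypothesis.RiemannHypothesis.Theorems.WeilGroundStateGroundStatesConvergeToXiEulerLagrange
import Summits.RiemannHypothesis.RiemannHypothesis.Theorems.WeilGroundStateGroundStatesConvergeToXiUniformBound
import Summits.RiemannHypothesis.RiemannHypothesis.Theorems.RuelleBandCofiniteCriticalLineStubBranchesContinuousAux
import HarnessLib

/-!
# Crux `GroundStateSimpleEven` (stmt-RiemannHypothesis-1526), line `parity-multiplicity-commutator`,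
# stub INTERTWINE — helper 1: linearity and `L²`-continuity of `f ↦ W(f ⋆ φ̃)`

Support file (`--supports stmt-RiemannHypothesis-1526`) for the stub
`stub_oddMinimisers_of_edgeCancelledPair`.  Normalisation of
`Literature/NumberTheory/LFunctions/WeilExplicit.lean`: `W = weilFunctional`, `Q g = W(g ⋆ g̃)`,
`g̃ = weilReflect g`, `⋆ = weilConv`, `ε(a) = weilGroundEnergy a`.

## Contents (everything proved; Mathlib + proved tree files only)

* §1 Linearity of `f ↦ W(f ⋆ φ̃)` on test functions (additivity of `W` on test kernels is
  `stub_branchesContinuous_weilFunctional_add` of `RuelleBandCofiniteCriticalLineStubBranchesContinuousAux.lean`,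
  imported; the public API file `WeilWindowSimpleEven.lean` cannot be imported next to
  `WeilGroundStateRealZerosProofs.lean`; Bombieri 2000 §3: `T` is linear).
* §2 **`L²`-continuity on the window**: for a test function `φ` and `a > 0` there is `C` with
  `‖W(f ⋆ φ̃)‖ ≤ C √∫|f|²` for every test function `f` supported in `[-a, a]`
  (`exists_norm_weilFunctional_weilConv_le_sqrt`; from the weighted `L¹` bound
  `norm_weilFunctional_weilConv_weilReflect_le` of `…ConvergeToXiUniformBound.lean` and
  Cauchy–Schwarz `‖f‖₁² ≤ 2a‖f‖₂²`, `weilNorm1_sq_le`).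
* §3 **The weak Euler–Lagrange equation is independent of the approximating sequence**: limits of
  `W(fₙ ⋆ φ̃)` transfer between `L²`-close sequences of window test functions
  (`tendsto_weilFunctional_weilConv_of_tendsto_sub`), and for two ground states `u₁, u₂` and
  scalars `c₁, c₂` EVERY sequence of window test functions `Pₙ → c₂u₁ − c₁u₂` in `L²` satisfies
  `W(Pₙ ⋆ φ̃) → ε(a) ∫ (c₂u₁ − c₁u₂) conj φ` (`tendsto_weilFunctional_weilConv_of_tendsto_comb`;
  Bombieri 2000 §4 Lemma 1 / (4.2) in weak form, via `IsWeilGroundState.exists_eulerLagrange`).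

No definitions, no named facts.
-/

noncomputable section

open Set MeasureTheory Filter Complex
open scoped Real Topology ComplexConjugate

namespace Summit.RiemannHypothesis.RiemannHypothesis.Theorems.GroundStateSimpleEven

open Literature.NumberTheory.LFunctions
open Summit.RiemannHypothesis.RiemannHypothesis.Theorems.GroundStatesConvergeToXi
open Summit.RiemannHypothesis.RiemannHypothesis.Theorems.RuelleBandCofiniteCriticalLine

-- `linter.dupNamespace` off: the mandated namespace `Summit.RiemannHypothesis.RiemannHypothesis.…`
-- (single-problem summit) repeats a component.
set_option linter.dupNamespace false

/-! ## §1. Linearity of `f ↦ W(f ⋆ φ̃)` on test functions -/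

section Algebra

variable {f g φ : ℝ → ℂ}

/-- The difference of two functions supported in the window is supported in the window. [folklore] -/
theorem tsupport_sub_subset_Icc {a : ℝ} (hf : tsupport f ⊆ Icc (-a) a)
    (hg : tsupport g ⊆ Icc (-a) a) : tsupport (f - g) ⊆ Icc (-a) a := by
  have e : f - g = f + fun t ↦ (-1 : ℂ) * g t := by
    funext t
    simp [sub_eq_add_neg]
  rw [e]
  exact (tsupport_add _ _).trans (union_subset hf (tsupport_mul_subset_right.trans hg))

/-- **Linearity of `f ↦ W(f ⋆ φ̃)`, sums**: `W((f + g) ⋆ φ̃) = W(f ⋆ φ̃) + W(g ⋆ φ̃)` for test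
functions `f, g, φ` (`ConvolutionExists.add_distrib` and additivity of `W` on test kernels). [folklore] -/
theorem weilFunctional_weilConv_add_left (hf : IsWeilTest f) (hg : IsWeilTest g)
    (hφ : IsWeilTest φ) :
    weilFunctional (weilConv (f + g) (weilReflect φ)) =
      weilFunctional (weilConv f (weilReflect φ)) + weilFunctional (weilConv g (weilReflect φ)) := by
  have hφ' := hφ.weilReflect
  have hconv : weilConv (f + g) (weilReflect φ) =
      weilConv f (weilReflect φ) + weilConv g (weilReflect φ) :=
    ConvolutionExists.add_distrib
      (hφ'.2.convolutionExists_right _ hf.1.continuous.locallyIntegrable hφ'.1.continuous)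
      (hφ'.2.convolutionExists_right _ hg.1.continuous.locallyIntegrable hφ'.1.continuous)
  rw [hconv, stub_branchesContinuous_weilFunctional_add (hf.weilConv hφ') (hg.weilConv hφ')]

/-- **Linearity of `f ↦ W(f ⋆ φ̃)`, scalars**: `W((c f) ⋆ φ̃) = c W(f ⋆ φ̃)` (no hypotheses:
`(c f) ⋆ h = c (f ⋆ h)` pointwise and `W(c k) = c W(k)`, `weilFunctional_const_mul`). [folklore] -/
theorem weilFunctional_weilConv_const_mul_left (c : ℂ) (f φ : ℝ → ℂ) :
    weilFunctional (weilConv (fun t ↦ c * f t) (weilReflect φ)) =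
      c * weilFunctional (weilConv f (weilReflect φ)) := by
  have hconv : weilConv (fun t ↦ c * f t) (weilReflect φ) =
      fun t ↦ c * weilConv f (weilReflect φ) t := by
    funext t
    rw [weilConv_apply, weilConv_apply, ← integral_const_mul]
    congr 1 with u
    ring
  rw [hconv, weilFunctional_const_mul]

/-- **Linearity of `f ↦ W(f ⋆ φ̃)`, differences**: `W((f − g) ⋆ φ̃) = W(f ⋆ φ̃) − W(g ⋆ φ̃)`. [folklore] -/
theorem weilFunctional_weilConv_sub_left (hf : IsWeilTest f) (hg : IsWeilTest g)
    (hφ : IsWeilTest φ) :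
    weilFunctional (weilConv (f - g) (weilReflect φ)) =
      weilFunctional (weilConv f (weilReflect φ)) - weilFunctional (weilConv g (weilReflect φ)) := by
  have e : f - g = f + fun t ↦ (-1 : ℂ) * g t := by
    funext t
    simp [sub_eq_add_neg]
  rw [e, weilFunctional_weilConv_add_left hf (hg.const_mul (-1)) hφ,
    weilFunctional_weilConv_const_mul_left]
  ring

end Algebra

/-! ## §2. `L²`-continuity of `f ↦ W(f ⋆ φ̃)` on the window -/

section Continuity

variable {a : ℝ} {φ : ℝ → ℂ}

/-- **`L²`-continuity of the polarised Weil functional on a window.** For a test function `φ`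
and `a > 0` there is `C ≥ 0` with `‖W(f ⋆ φ̃)‖ ≤ C √(∫|f|²)` for every test function `f` with
`tsupport f ⊆ [-a, a]`: by `norm_weilFunctional_weilConv_weilReflect_le` (exponent `b₀ = 1`),
`‖W(f ⋆ φ̃)‖ ≤ C₀ ∫|f| e^{|t|} ≤ C₀ e^{a} ‖f‖₁ ≤ C₀ e^{a} √(2a) ‖f‖₂` (Cauchy–Schwarz on the
window, `weilNorm1_sq_le`). (Bombieri 2000 §4: `T[f * ḡ*]` is a bounded hermitian form on
`L²(E)`.) [folklore] -/
theorem exists_norm_weilFunctional_weilConv_le_sqrt (ha : 0 < a) (hφ : IsWeilTest φ) :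
    ∃ C : ℝ, 0 ≤ C ∧ ∀ f : ℝ → ℂ, IsWeilTest f → tsupport f ⊆ Icc (-a) a →
      ‖weilFunctional (weilConv f (weilReflect φ))‖ ≤ C * √(∫ t, ‖f t‖ ^ 2) := by
  obtain ⟨C₀, hC₀, hb⟩ := norm_weilFunctional_weilConv_weilReflect_le hφ (b₀ := 1) (by norm_num)
  refine ⟨C₀ * (Real.exp a * √(2 * a)), by positivity, fun f hf hfs ↦ ?_⟩
  have h1 := hb f hf
  have h2 : ∫ t, ‖f t‖ * Real.exp (1 * |t|) ≤ Real.exp a * weilNorm1 f := by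
    rw [weilNorm1, ← integral_const_mul]
    refine integral_mono_of_nonneg (Eventually.of_forall fun t ↦ by positivity)
      (((hf.1.continuous.norm).integrable_of_hasCompactSupport hf.2.norm).const_mul _)
      (Eventually.of_forall fun t ↦ ?_)
    dsimp only
    by_cases ht : t ∈ Icc (-a) a
    · rw [mul_comm (Real.exp a)]
      refine mul_le_mul_of_nonneg_left (Real.exp_le_exp.2 ?_) (norm_nonneg _)
      rw [one_mul]
      exact abs_le.2 ⟨ht.1, ht.2⟩
    · rw [eq_zero_of_tsupport_subset hfs ht]
      simp
  have h3 : weilNorm1 f ≤ √(2 * a) * √(∫ t, ‖f t‖ ^ 2) := by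
    have hsq := weilNorm1_sq_le hf ha hfs
    rw [weilNorm2Sq] at hsq
    rw [← Real.sqrt_mul (by positivity : (0 : ℝ) ≤ 2 * a)]
    have h := Real.abs_le_sqrt hsq
    rwa [abs_of_nonneg (weilNorm1_nonneg f)] at h
  calc ‖weilFunctional (weilConv f (weilReflect φ))‖
      ≤ C₀ * ∫ t, ‖f t‖ * Real.exp (1 * |t|) := h1
    _ ≤ C₀ * (Real.exp a * weilNorm1 f) := mul_le_mul_of_nonneg_left h2 hC₀
    _ ≤ C₀ * (Real.exp a * (√(2 * a) * √(∫ t, ‖f t‖ ^ 2))) := by gcongr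
    _ = C₀ * (Real.exp a * √(2 * a)) * √(∫ t, ‖f t‖ ^ 2) := by ring

end Continuity

/-! ## §3. The weak Euler–Lagrange equation along arbitrary approximating sequences -/

section Transfer

variable {a : ℝ} {φ V u₁ u₂ : ℝ → ℂ} {f f' : ℕ → ℝ → ℂ}

/-- `∫|f − g|² ≤ 2∫|f − V|² + 2∫|g − V|²` for square-integrable `f, g, V`. [folklore] -/
theorem integral_norm_sq_sub_le_two_mul {f g V : ℝ → ℂ} (hf : MemLp f 2) (hg : MemLp g 2)
    (hV : MemLp V 2) :
    ∫ t, ‖f t - g t‖ ^ 2 ≤ 2 * (∫ t, ‖f t - V t‖ ^ 2) + 2 * ∫ t, ‖g t - V t‖ ^ 2 := by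
  have i1 : Integrable fun t ↦ ‖f t - V t‖ ^ 2 :=
    (memLp_two_iff_integrable_sq_norm (hf.sub hV).1).1 (hf.sub hV)
  have i2 : Integrable fun t ↦ ‖g t - V t‖ ^ 2 :=
    (memLp_two_iff_integrable_sq_norm (hg.sub hV).1).1 (hg.sub hV)
  have key : ∫ t, ‖f t - g t‖ ^ 2 ≤ ∫ t, (2 * ‖f t - V t‖ ^ 2 + 2 * ‖g t - V t‖ ^ 2) := by
    refine integral_mono_of_nonneg (Eventually.of_forall fun t ↦ by positivity)
      ((i1.const_mul 2).add (i2.const_mul 2)) (Eventually.of_forall fun t ↦ ?_)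
    dsimp only
    have h1 : ‖f t - g t‖ ≤ ‖f t - V t‖ + ‖g t - V t‖ := by
      rw [show f t - g t = (f t - V t) - (g t - V t) by ring]
      exact norm_sub_le _ _
    nlinarith [norm_nonneg (f t - g t), norm_nonneg (f t - V t), norm_nonneg (g t - V t),
      sq_nonneg (‖f t - V t‖ - ‖g t - V t‖)]
  rw [integral_add (i1.const_mul 2) (i2.const_mul 2), integral_const_mul, integral_const_mul] at key
  exact key

/-- Two sequences with a common `L²`-limit are `L²`-close: `∫|fₙ − f'ₙ|² → 0`. [folklore] -/
theorem tendsto_integral_norm_sq_sub_of_common_limit (hV : MemLp V 2) (hf : ∀ n, MemLp (f n) 2)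
    (hf' : ∀ n, MemLp (f' n) 2)
    (hfl : Tendsto (fun n ↦ ∫ t, ‖f n t - V t‖ ^ 2) atTop (𝓝 0))
    (hf'l : Tendsto (fun n ↦ ∫ t, ‖f' n t - V t‖ ^ 2) atTop (𝓝 0)) :
    Tendsto (fun n ↦ ∫ t, ‖f n t - f' n t‖ ^ 2) atTop (𝓝 0) := by
  refine squeeze_zero (fun n ↦ integral_nonneg fun _ ↦ by positivity)
    (fun n ↦ integral_norm_sq_sub_le_two_mul (hf n) (hf' n) hV) ?_
  have h := (hfl.const_mul 2).add (hf'l.const_mul 2)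
  simpa using h

/-- **Transfer of limits of `W(fₙ ⋆ φ̃)` between `L²`-close sequences of window test functions.**
If `fₙ, f'ₙ` are test functions on `[-a, a]` with `∫|fₙ − f'ₙ|² → 0` and `W(fₙ ⋆ φ̃) → L`, then
`W(f'ₙ ⋆ φ̃) → L` (`|W((fₙ − f'ₙ) ⋆ φ̃)| ≤ C‖fₙ − f'ₙ‖₂`). [folklore] -/
theorem tendsto_weilFunctional_weilConv_of_tendsto_sub (ha : 0 < a) (hφ : IsWeilTest φ)
    (hf : ∀ n, IsWeilTest (f n) ∧ tsupport (f n) ⊆ Icc (-a) a)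
    (hf' : ∀ n, IsWeilTest (f' n) ∧ tsupport (f' n) ⊆ Icc (-a) a)
    (hclose : Tendsto (fun n ↦ ∫ t, ‖f n t - f' n t‖ ^ 2) atTop (𝓝 0)) {L : ℂ}
    (hL : Tendsto (fun n ↦ weilFunctional (weilConv (f n) (weilReflect φ))) atTop (𝓝 L)) :
    Tendsto (fun n ↦ weilFunctional (weilConv (f' n) (weilReflect φ))) atTop (𝓝 L) := by
  obtain ⟨C, -, hC⟩ := exists_norm_weilFunctional_weilConv_le_sqrt ha hφ
  have hdiff : Tendsto (fun n ↦ weilFunctional (weilConv (f n) (weilReflect φ)) -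
      weilFunctional (weilConv (f' n) (weilReflect φ))) atTop (𝓝 0) := by
    refine squeeze_zero_norm (a := fun n ↦ C * √(∫ t, ‖f n t - f' n t‖ ^ 2)) (fun n ↦ ?_) ?_
    · rw [← weilFunctional_weilConv_sub_left (hf n).1 (hf' n).1 hφ]
      exact hC _ (IsWeilTest.sub (hf n).1 (hf' n).1) (tsupport_sub_subset_Icc (hf n).2 (hf' n).2)
    · have h := (hclose.sqrt).const_mul C
      simpa using h
  have h := hL.sub hdiff
  rw [sub_zero] at h
  refine h.congr fun n ↦ ?_
  ring

/-- `∫|(fₙ + c gₙ) − (F + c G)|² → 0` from `fₙ → F`, `gₙ → G` in `L²`, pointwise-in-`t` form of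
`ConnesVanSuijlekom.tendsto_integral_norm_sq_add_mul` for the combination `c₂ gₙ¹ − c₁ gₙ²`. [folklore] -/
theorem tendsto_integral_norm_sq_comb {F G : ℝ → ℂ} {g₁ g₂ : ℕ → ℝ → ℂ} (hF : MemLp F 2)
    (hG : MemLp G 2) (hg₁ : ∀ n, MemLp (g₁ n) 2) (hg₂ : ∀ n, MemLp (g₂ n) 2) (c₁ c₂ : ℂ)
    (h₁ : Tendsto (fun n ↦ ∫ t, ‖g₁ n t - F t‖ ^ 2) atTop (𝓝 0))
    (h₂ : Tendsto (fun n ↦ ∫ t, ‖g₂ n t - G t‖ ^ 2) atTop (𝓝 0)) :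
    Tendsto (fun n ↦ ∫ t, ‖(c₂ * g₁ n t - c₁ * g₂ n t) - (c₂ * F t - c₁ * G t)‖ ^ 2)
      atTop (𝓝 0) := by
  -- first `0 + c₂ g₁ₙ → 0 + c₂ F`, then add `(-c₁) g₂ₙ → (-c₁) G`
  have h0 : Tendsto (fun n ↦ ∫ t, ‖((0 : ℝ → ℂ) t + c₂ * g₁ n t) - ((0 : ℝ → ℂ) t + c₂ * F t)‖ ^ 2)
      atTop (𝓝 0) :=
    ConnesVanSuijlekom.tendsto_integral_norm_sq_add_mul (f := fun _ ↦ (0 : ℝ → ℂ)) MemLp.zero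
      (fun _ ↦ MemLp.zero) hF hg₁ c₂ (by simp) h₁
  simp only [Pi.zero_apply, zero_add] at h0
  have h3 := ConnesVanSuijlekom.tendsto_integral_norm_sq_add_mul (f := fun n t ↦ c₂ * g₁ n t)
    (F := fun t ↦ c₂ * F t) (hF.const_mul c₂) (fun n ↦ (hg₁ n).const_mul c₂) hG hg₂ (-c₁) h0 h₂
  refine h3.congr fun n ↦ ?_
  congr 1 with t
  ring_nf

/-- **Weak Euler–Lagrange equation for a combination of two ground states, along EVERY
approximating sequence.** Let `u₁, u₂` be ground states at window `a`, `c₁ c₂ : ℂ`, and let `Pₙ`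
be window test functions with `Pₙ → c₂u₁ − c₁u₂` in `L²`. Then for every window test function
`φ`, `W(Pₙ ⋆ φ̃) → ε(a) ∫ (c₂u₁ − c₁u₂) conj φ`. Proof: along the minimising sequences `gₙⁱ → uᵢ`
of `IsWeilGroundState.exists_eulerLagrange`, `W(gₙⁱ ⋆ φ̃) → ε(a)⟨uᵢ, φ⟩` (Bombieri 2000 §4
(4.2), weak form); combine linearly and transfer to `Pₙ` by `L²`-continuity
(`tendsto_weilFunctional_weilConv_of_tendsto_sub`). [folklore] -/
theorem tendsto_weilFunctional_weilConv_of_tendsto_comb (hu₁ : IsWeilGroundState a u₁)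
    (hu₂ : IsWeilGroundState a u₂) (c₁ c₂ : ℂ) {P : ℕ → ℝ → ℂ}
    (hP : ∀ n, IsWeilTest (P n) ∧ tsupport (P n) ⊆ Icc (-a) a)
    (hPL : Tendsto (fun n ↦ ∫ t, ‖P n t - (c₂ * u₁ t - c₁ * u₂ t)‖ ^ 2) atTop (𝓝 0))
    (hφ : IsWeilTest φ) (hφs : tsupport φ ⊆ Icc (-a) a) :
    Tendsto (fun n ↦ weilFunctional (weilConv (P n) (weilReflect φ))) atTop
      (𝓝 ((weilGroundEnergy a : ℂ) * ∫ t, (c₂ * u₁ t - c₁ * u₂ t) * conj (φ t))) := by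
  have ha : 0 < a := hu₁.pos
  obtain ⟨g₁, hg₁, -, hL₁, hE₁⟩ := hu₁.exists_eulerLagrange
  obtain ⟨g₂, hg₂, -, hL₂, hE₂⟩ := hu₂.exists_eulerLagrange
  set G : ℕ → ℝ → ℂ := fun n t ↦ c₂ * g₁ n t - c₁ * g₂ n t with hGdef
  have hGt : ∀ n, IsWeilTest (G n) ∧ tsupport (G n) ⊆ Icc (-a) a := fun n ↦
    ⟨IsWeilTest.sub ((hg₁ n).1.const_mul c₂) ((hg₂ n).1.const_mul c₁),
      tsupport_sub_subset_Icc (tsupport_mul_subset_right.trans (hg₁ n).2.1)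
        (tsupport_mul_subset_right.trans (hg₂ n).2.1)⟩
  have hGL : Tendsto (fun n ↦ ∫ t, ‖G n t - (c₂ * u₁ t - c₁ * u₂ t)‖ ^ 2) atTop (𝓝 0) :=
    tendsto_integral_norm_sq_comb hu₁.memLp hu₂.memLp
      (fun n ↦ ConnesVanSuijlekom.isWeilTest_memLp (hg₁ n).1)
      (fun n ↦ ConnesVanSuijlekom.isWeilTest_memLp (hg₂ n).1) c₁ c₂ hL₁ hL₂
  -- Euler–Lagrange along `Gₙ`
  have hφc : Continuous fun t ↦ conj (φ t) := Complex.continuous_conj.comp hφ.1.continuous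
  have hi₁ : Integrable fun t ↦ u₁ t * conj (φ t) := hu₁.integrable_mul_continuous hφc
  have hi₂ : Integrable fun t ↦ u₂ t * conj (φ t) := hu₂.integrable_mul_continuous hφc
  have hGE : Tendsto (fun n ↦ weilFunctional (weilConv (G n) (weilReflect φ))) atTop
      (𝓝 ((weilGroundEnergy a : ℂ) * ∫ t, (c₂ * u₁ t - c₁ * u₂ t) * conj (φ t))) := by
    have hsplit : ∀ n, weilFunctional (weilConv (G n) (weilReflect φ)) =
        c₂ * weilFunctional (weilConv (g₁ n) (weilReflect φ)) -
          c₁ * weilFunctional (weilConv (g₂ n) (weilReflect φ)) := by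
      intro n
      have e : G n = (fun t ↦ c₂ * g₁ n t) - fun t ↦ c₁ * g₂ n t := rfl
      rw [e, weilFunctional_weilConv_sub_left ((hg₁ n).1.const_mul c₂) ((hg₂ n).1.const_mul c₁) hφ,
        weilFunctional_weilConv_const_mul_left, weilFunctional_weilConv_const_mul_left]
    have hint : ∫ t, (c₂ * u₁ t - c₁ * u₂ t) * conj (φ t) =
        c₂ * (∫ t, u₁ t * conj (φ t)) - c₁ * ∫ t, u₂ t * conj (φ t) := by
      rw [← integral_const_mul, ← integral_const_mul,
        ← integral_sub (hi₁.const_mul c₂) (hi₂.const_mul c₁)]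
      congr 1 with t
      ring
    simp_rw [hsplit, hint]
    have h := ((hE₁ φ hφ hφs).const_mul c₂).sub ((hE₂ φ hφ hφs).const_mul c₁)
    convert h using 2
    ring
  -- transfer to `Pₙ`
  refine tendsto_weilFunctional_weilConv_of_tendsto_sub ha hφ hGt hP ?_ hGE
  exact tendsto_integral_norm_sq_sub_of_common_limit ((hu₁.memLp.const_mul c₂).sub
    (hu₂.memLp.const_mul c₁)) (fun n ↦ ConnesVanSuijlekom.isWeilTest_memLp (hGt n).1)
    (fun n ↦ ConnesVanSuijlekom.isWeilTest_memLp (hP n).1) hGL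
    (by simpa only [Pi.sub_apply] using hPL)

end Transfer

end Summit.RiemannHypothesis.RiemannHypothesis.Theorems.GroundStateSimpleEven

namespace Summit.RiemannHypothesis.RiemannHypothesis.Theorems

open Literature.NumberTheory.LFunctions

set_option linter.dupNamespace false in
/-- **Registered sub-goal of stub INTERTWINE (helper 1): the weak Euler–Lagrange equation of a
combination of two ground states holds along every approximating sequence.** For ground states
`u₁, u₂` at window `a`, scalars `c₁, c₂`, window test functions `Pₙ → c₂u₁ − c₁u₂` in `L²`, and
every window test function `φ`: `W(Pₙ ⋆ φ̃) → ε(a) ∫ (c₂u₁ − c₁u₂) conj φ`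
(`GroundStateSimpleEven.tendsto_weilFunctional_weilConv_of_tendsto_comb`; Bombieri 2000 §4 (4.2),
weak form). [folklore] -/
theorem stub_intertwine_eulerLagrangeTransfer :
    ∀ a : ℝ, ∀ u₁ u₂ : ℝ → ℂ, IsWeilGroundState a u₁ → IsWeilGroundState a u₂ → ∀ c₁ c₂ : ℂ,
      ∀ P : ℕ → ℝ → ℂ, (∀ n, IsWeilTest (P n) ∧ tsupport (P n) ⊆ Icc (-a) a) →
        Tendsto (fun n => ∫ t, ‖P n t - (c₂ * u₁ t - c₁ * u₂ t)‖ ^ 2) atTop (𝓝 0) →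
        ∀ φ : ℝ → ℂ, IsWeilTest φ → tsupport φ ⊆ Icc (-a) a →
          Tendsto (fun n => weilFunctional (weilConv (P n) (weilReflect φ))) atTop
            (𝓝 ((weilGroundEnergy a : ℂ) *
              ∫ t, (c₂ * u₁ t - c₁ * u₂ t) * starRingEnd ℂ (φ t))) :=
  fun _ _ _ hu₁ hu₂ c₁ c₂ _ hP hPL _ hφ hφs =>
    GroundStateSimpleEven.tendsto_weilFunctional_weilConv_of_tendsto_comb hu₁ hu₂ c₁ c₂ hP hPL hφ hφs

end Summit.RiemannHypothesis.RiemannHypothesis.Theorems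

end
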